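import Summits.QuantumFields.YangMills.Theorems.BalabanUVNodesN06RgddLegAtPinsT
import Literature.MathematicalPhysics.QuantumFieldTheory.Balaban1983to89.B9DivLetterTransportedAtPins
import Literature.MathematicalPhysics.QuantumFieldTheory.Balaban1983to89.B9Thm313WholeRDvsWordPrintCurrency
import Literature.MathematicalPhysics.QuantumFieldTheory.Balaban1983to89.B9Thm313WholeG1PairMembersRegular
import Literature.MathematicalPhysics.QuantumFieldTheory.Balaban1983to89.B9CoReadingCoordsInputExpMono
import Literature.MathematicalPhysics.QuantumFieldTheory.Balaban1983to89.B9PerturbationMajorantsAtLettersPhys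
import Literature.MathematicalPhysics.QuantumFieldTheory.Balaban1983to89.B9CoReadingCoordsH

/-!
# CASCADE-K «K3-D» (director-ym №383) — THE SITE-TRANSPORTER-PARAMETRIC RE-PRESS of `N06RgddLegAtPinsT`: `rgdd_of_pinsT_par` = the landed `rgdd_of_pinsT` VERBATIM with the record's symmetric site transporter `parSymY x.toKIdx` replaced by a PARAMETER `parT : ∀ i, SiteParY _ i` (every `GpY ∕ GpPhysY ∕ TpicoK ∕ T2coK ∕ RcoK …` letter read at `parT x.toKIdx`; proofs verbatim — the callees are transporter-generic or their landed `_par` twins are called).  At `parT := fun i => parSymY i` these ARE the originals; at the knit transporter they serve the knit certificate's Sect.-D network «KD» (dag-n06-d g25∕g26, HOME `K3D-CENSUS-g25.md`).  Seat `pub-ymgap-dag-n06-d` (g26), 2026-08-30.  The original module text below applies word for word otherwise.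
#

# BalabanUVNodes ∕ N06 ([B9], `Dag.B9_main`) — THE DISPLAYED SMOOTH-SOURCE LETTER `hrgdd13` (`R(U)·D*_U·G₁(U)·∇*_{U,μ}` from the flat bond input class INTO the
# TRANSPORTED site input class `bHXT x U = bHZPIfam (taxiS U)`) AT THE PINS, MEMBER-UNIFORMLY — the certificate-side LEG (D) of dag-n06-l's P-HRGDD programme

Track A of `YM-PLAN.md` (cell `pub-ymgap`, HUMAN RULING D-0062), node **N06** = [Balaban1985BackgroundPropagators] Thms 3.1–3.15; rows 20–21; seat `pub-ymgap-dag-n06-c` (g22;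
«LEG := n06-c», dag-n06-l g32 I.32192, dag-lead g31 WORDS 258).
A HELPER for dag-n06-d's certificate editions after ED.107 «VH»: there `hrgdd13` — `R(U)∘D*_U∘G₁(U)∘∇*_{U,μ} : bHXA x ε → bHW13 x U ε'` at `(Br13 ε ε', δ12₃)`, guards
`0 < ε' < 1`, `ε' < ε ≤ ε' + 1` — is DISPLAYED; the face's W slot `bHW13` is free (n06-l g32), so with `bHW13 := bHXT` (the transported site input class of ED.95) THIS FILE supplies
it: ★★★ `rgdd_of_pinsT`.  The proof is member-level plumbing of LANDED theorems, per member `x`, configuration `U` in the regime, direction `μ`, exponents `(ε, ε')`: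
(A) dag-n06-l's `B9Thm313WholeG1PairMembersRegular.g1Pair_members_of_stateS` (the (3.44)∕(3.45) pair members of `G₁∇*_μ` out of the regular state: the G₀ layer `hG0`, the
identities `hI`, the state-layer tuple `hst` — the face's `hst10` shape at its own rates `δKR ∕ δPR` — and the ℓ¹ control `hdomX`), read at `ε₁ := min ε 1` (sup member, climbed
to `ε` by `B9CoReadingCoordsInputExpMono.hasMaj_bHK_of_le` through the pin `hbHX12`) and at `(ε − ε', ε')` (probe member, pins `hblkPX ∕ hΦX`); (B) this seat's letters
`B9DivLetterTransportedAtPins.hasMaj_JTcoKH_bHZKP_bHZP_pinsR` (`J†_ν : bHZKP (taxiB U) ε' → bHZP (taxiS U) ε'`, ladder-free under (3.35)) and `hasMaj_JTcoKH_cNormR_neg_one_pinsR`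
(the sup twin); the split `D*_U = Σ_ν J†_ν ∘ ∇_{U,ν}` (`B9DivViaGradLettersAtPins.DvscoKH_eq_sum` at the pins `hDvsco12 ∕ hDd`); (3.49)'s words of `P` (`h49.p_cls ∕ .dvP_cls`) and
`R = ϱ(I − P)` (`hRco12`, `rcoK_GpPhysY`, `rcoK_eq`); all fed to dag-n06-l's print-currency core `B9Thm313WholeRDvsWordPrintCurrency.hasMaj_R_dvs_comp_into_bHZPIfam`
(transfer `ε_t := τ`, row-sum margin `σ := τ`, (2.60) loss `αδ_F := ½·2τ`).  RATE LEDGER (the numerics the certificate must display, one margin `τ > 0`):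
`δ12₃ + 3τ ≤ δ12₀` (G₀ layer), `δ12₃ + 4τ ≤ δPR`, `δ12₃ + 5τ ≤ δKR` (state layer), `δ12₃ + 3τ ≤ δ49` ((3.49)); the smallness `(bXH).κ·θS·Mα₀·c ≤ ½` of (A) is met on the
output regime `Mα₀ ≤ aR` (`aR ≤ a₁` explicit in the row-sum constant).  Output: ∃ `MR ≥ M₁`, `0 < aR ≤ a₁`, a profile `Br ε ε' ≥ 0`, such that above `MR`, for `Mα₀ ≤ aR`:
`HasMaj (bHX12 x ε) (bHXT x U ε') ((𝔬12 x).R U ∘ₗ (𝔬12 x).Dvstar U ∘ₗ (𝔬12 x).G1 U ∘ₗ Dds x U μ) (Br ε ε'·e^{−δ12₃ d})` under the four guards — the displayed shape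
with `bHW13 := bHXT`.
HONEST FRAMING.  By-name composition of kernel-checked helper files; the G₀ layer, the state layer, the identities, (3.49) are HYPOTHESES (the certificate derives them);
COUNT-NEUTRAL; nothing of [B9]'s propagator estimates asserted; N06 NOT discharged; K1 NOT closed; one finite 𝕋⁴ programme at fixed `ε` — NOT continuum, NOT OS, NOT the
mass gap ∕ Clay.  0 `def`, 0 `sorry`.
-/

noncomputable section

namespace Summit.QuantumFields.YangMills.BalabanUVNodes.N06RgddLegAtPinsTPar

open Literature.MathematicalPhysics.QuantumFieldTheory.Balaban1983to89
open Literature.MathematicalPhysics.QuantumFieldTheory.Balaban1983to89.Node00 (FBondY IBondY CfgY GpY GpPhysY parSymY)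
open Literature.MathematicalPhysics.QuantumFieldTheory.Balaban1983to89.Node00.OpsYSectDCoords (DvcoKH DvscoKH RcoK cR39_trBasis_pos)
open Literature.MathematicalPhysics.QuantumFieldTheory.Balaban1983to89.B9Thm34Ext (toB6)
open Literature.MathematicalPhysics.QuantumFieldTheory.Balaban1983to89.B11SectG (BlockNorm HasMaj RowSum)
open Literature.MathematicalPhysics.QuantumFieldTheory.Balaban1983to89.B9Thm312Whole (GeoOK)
open Literature.MathematicalPhysics.QuantumFieldTheory.Balaban1983to89.B9Thm312WholeClasses (cNormR)
open Literature.MathematicalPhysics.QuantumFieldTheory.Balaban1983to89.B9Thm312WholeDir (Thm33G0Dir)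
open Literature.MathematicalPhysics.QuantumFieldTheory.Balaban1983to89.B9Thm312WholeStepRegular (StepS)
open Literature.MathematicalPhysics.QuantumFieldTheory.Balaban1983to89.B9Thm313WholeG1PairMembersRegular (g1Pair_members_of_stateS)
open Literature.MathematicalPhysics.QuantumFieldTheory.Balaban1983to89.B9Thm313WholeRDvsWordPrintCurrency (hasMaj_R_dvs_comp_into_bHZPIfam)
open Literature.MathematicalPhysics.QuantumFieldTheory.Balaban1983to89.B9RWSums343Holder (HolderProbes)
open Literature.MathematicalPhysics.QuantumFieldTheory.Balaban1983to89.B9RWSums343to347Whole (Facts347)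
open Literature.MathematicalPhysics.QuantumFieldTheory.Balaban1983to89.B9RWSums347DefiniteFaces (exp261 facts347_exp261_geo9Y)
open Literature.MathematicalPhysics.QuantumFieldTheory.Balaban1983to89.B9PinMembersKLevelV1 (MemberY geo9Y geo9Y_M)
open Literature.MathematicalPhysics.QuantumFieldTheory.Balaban1983to89.B9BackgroundsKLevelV1R (RegFamY bg9YR)
open Literature.MathematicalPhysics.QuantumFieldTheory.Balaban1983to89.B9BackgroundsKLevelV1P (bg9KP mem_of_reg335P)
open Literature.MathematicalPhysics.QuantumFieldTheory.Balaban1983to89.B9GeoLemma21KLevelV1 (geo9Y_len_pos geo9Y_dist_triangle geo9Y_dist_comm rowSum261_geo9Y)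
open Literature.MathematicalPhysics.QuantumFieldTheory.Balaban1983to89.B9GeoNormsKLevelV1 (geo9K geo9K_dist_nonneg)
open Literature.MathematicalPhysics.QuantumFieldTheory.Balaban1983to89.B7Prop2SpecialUnitary (specialUnitaryUnits specialUnitaryUnits_le_U1)
open Literature.MathematicalPhysics.QuantumFieldTheory.Balaban1983to89.B9CoReadingCoords (XBK blkBK coordOpK cdBₗ)
open Literature.MathematicalPhysics.QuantumFieldTheory.Balaban1983to89.B9CoReadingCoordsH (XHK)
open Literature.MathematicalPhysics.QuantumFieldTheory.Balaban1983to89.B9CoReadingCoordsS (XSK blkSK sIK)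
open Literature.MathematicalPhysics.QuantumFieldTheory.Balaban1983to89.B9CoReadingCoordsHolder (PK blkPK probeK w₀K)
open Literature.MathematicalPhysics.QuantumFieldTheory.Balaban1983to89.B9CoReadingCoordsHolderAdm (wKA)
open Literature.MathematicalPhysics.QuantumFieldTheory.Balaban1983to89.B9CoReadingCoordsInput (bHK)
open Literature.MathematicalPhysics.QuantumFieldTheory.Balaban1983to89.B9CoReadingCoordsInputExpMono (hasMaj_bHK_of_le)
open Literature.MathematicalPhysics.QuantumFieldTheory.Balaban1983to89.B9CoReadingCoordsTranspose (TrIdx trBasis)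
open Literature.MathematicalPhysics.QuantumFieldTheory.Balaban1983to89.B9Thm39ReadingCoords (cR39 cR39_nonneg coordBound39 basisBound39)
open Literature.MathematicalPhysics.QuantumFieldTheory.Balaban1983to89.B9MultiscaleSmoothPartitionYLip (CLip CLip_nonneg)
open Literature.MathematicalPhysics.QuantumFieldTheory.Balaban1983to89.B9MultiscaleSmoothPartitionYNear (rNear)
open Literature.MathematicalPhysics.QuantumFieldTheory.Balaban1983to89.B9SmoothHolderClassPI (bHZPIfam transfer_threshold_geo9K)
open Literature.MathematicalPhysics.QuantumFieldTheory.Balaban1983to89.B9SmoothHolderClassPProducers (CTel)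
open Literature.MathematicalPhysics.QuantumFieldTheory.Balaban1983to89.B9SmoothHolderClassTClosure (abs_cf_eq_nKT)
open Literature.MathematicalPhysics.QuantumFieldTheory.Balaban1983to89.B9SectBGpLettersY (norm_le_one_and_inv_of_mem)
open Literature.MathematicalPhysics.QuantumFieldTheory.Balaban1983to89.B9GradViaDivLettersTransported (taxiS taxiB)
open Literature.MathematicalPhysics.QuantumFieldTheory.Balaban1983to89.B9GradViaDivLettersAtPins (rJ)
open Literature.MathematicalPhysics.QuantumFieldTheory.Balaban1983to89.B9DivViaGradLettersAtPins (JTcoKH DvscoKH_eq_sum)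
open Literature.MathematicalPhysics.QuantumFieldTheory.Balaban1983to89.B9DivLetterTransportedAtPins (hasMaj_JTcoKH_bHZKP_bHZP_pinsR hasMaj_JTcoKH_cNormR_neg_one_pinsR)
open Literature.MathematicalPhysics.QuantumFieldTheory.Balaban1983to89.B9PerturbationMajorantAlgebra (Proj349Maj)
open Literature.MathematicalPhysics.QuantumFieldTheory.Balaban1983to89.B9PerturbationMajorantsAtLetters (PcoK rcoK_eq)
open Literature.MathematicalPhysics.QuantumFieldTheory.Balaban1983to89.B9PerturbationMajorantsAtLettersPhys (rcoK_GpPhysY)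
open Literature.MathematicalPhysics.QuantumFieldTheory.Balaban1983to89.B6GlobalChartV1 (blkV1)
open Literature.MathematicalPhysics.QuantumFieldTheory.Balaban1983to89.B6Ineq2142KLevelV1 (β lvl)
open Literature.MathematicalPhysics.QuantumFieldTheory.Balaban1983to89.B6Geom246MultiLevelTorus (geomT)
open Literature.MathematicalPhysics.QuantumFieldTheory.Balaban1983to89.B6KLevelCensusIndexV1 (kGeo)
open T4RelativeLadder (UnitaryLike)
open scoped Matrix.Norms.L2Operator

variable {N : ℕ} [NeZero N]
variable {d ℓ : ℕ} {hd : 1 ≤ d + 1} {hL : Odd (ℓ + 1) ∧ 1 < ℓ + 1} {b₀ b₁ : ℝ} {Mstar : ℕ}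
variable [∀ x : MemberY d ℓ hd hL b₀ b₁ Mstar, Fintype (geo9Y x).Site]

set_option maxHeartbeats 3200000 in -- the member-level instantiation of three norm-generic cores unfolds `bg9YR … x` ∕ `geo9Y x` at every pin
/-- ★★★ **`hrgdd13` AT THE TRANSPORTED W-SECTOR CLASS, MEMBER-UNIFORMLY** (module docstring): from the G₀ layer `hG0`, the identities `hI`, the state-layer tuple `hst` (the face's
`hst10` shape at rates `δKR ∕ δPR`), the ℓ¹ control `hdomX`, (3.49)'s `h49`, the pins `hblk12 hblkPX hΦX hDvsco12 hRco12 hDd hbHXT hbHX12 hβ1 hlev hbI0`, print's class `hP`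
(`c10 ≤ 10`), and one rate margin `τ > 0` with `δ12₃ + 3τ ≤ δ12₀`, `δ12₃ + 4τ ≤ δPR`, `δ12₃ + 5τ ≤ δKR`, `δ12₃ + 3τ ≤ δ49`: ∃ `MR ≥ M₁`, `0 < aR ≤ a₁`, `Br ≥ 0` with the displayed
letter at `(Br ε ε', δ12₃)`, source `bHX12 x ε`, target `bHXT x U ε'`, above `MR` and for `Mα₀ ≤ aR`.
[cite: Balaban1985BackgroundPropagators, Thm 3.12–3.13 (3.130)–(3.133) pp.421–422 + (3.153) p.426 + Thm 3.3 (3.44)–(3.45) p.398 + (3.49) p.399 + (3.8) p.392 + (3.40) p.397 + (3.35) p.396; Balaban1984PropagatorsII, (2.51)–(2.56) pp.232–233, Lemma 2.1 (2.60)–(2.61) p.234, (2.137) p.247] -/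
theorem rgdd_of_pinsT_par
    (parT : ∀ i : B6KLevelCensusIndexV1.KIdx d ℓ hd hL b₀ b₁, Node00.SiteParY (Matrix (Fin N) (Fin N) ℂ) i) {R₁ R₂ : RegFamY d ℓ hd hL b₀ b₁ Mstar (Matrix (Fin N) (Fin N) ℂ)} (H12 : MemberY d ℓ hd hL b₀ b₁ Mstar → Prop)
    (bI : ∀ x : MemberY d ℓ hd hL b₀ b₁ Mstar, FBondY x.toKIdx → IBondY x.toKIdx)
    (hβ1 : ∀ (x : MemberY d ℓ hd hL b₀ b₁ Mstar) (f : FBondY x.toKIdx), (geomT x.toKIdx.D).dist (β x.toKIdx.hN x.toKIdx.D x.toKIdx.hk (bI x f)) (blkV1 x.toKIdx.hN x.toKIdx.D f) ≤ 1)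
    (hlev : ∀ (x : MemberY d ℓ hd hL b₀ b₁ Mstar) (f : FBondY x.toKIdx), lvl x.toKIdx.hN x.toKIdx.D x.toKIdx.hk (bI x f) = (blkV1 x.toKIdx.hN x.toKIdx.D f).1.1)
    (hbI0 : ∀ (x : MemberY d ℓ hd hL b₀ b₁ Mstar) (f : FBondY x.toKIdx), bI x f = bI x ⟨f.src, 0⟩)
    [∀ x : MemberY d ℓ hd hL b₀ b₁ Mstar, DecidableRel (B9CoRealizesRelAtLetters.RelB x.toKIdx)]
    (𝔬12 : ∀ x : MemberY d ℓ hd hL b₀ b₁ Mstar, B9Thm312Whole.Ops (geo9Y x) (bg9YR (Matrix (Fin N) (Fin N) ℂ) (specialUnitaryUnits (Fin N)) R₁ R₂ x) (XBK (TrIdx N) x.toKIdx) (XBK (TrIdx N) x.toKIdx) (XHK (TrIdx N) x.toKIdx) (XSK (TrIdx N) x.toKIdx))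
    (𝔭A : ∀ x : MemberY d ℓ hd hL b₀ b₁ Mstar, HolderProbes (geo9Y x) (bg9YR (Matrix (Fin N) (Fin N) ℂ) (specialUnitaryUnits (Fin N)) R₁ R₂ x) (XBK (TrIdx N) x.toKIdx) (XBK (TrIdx N) x.toKIdx)
      (PK (FBondY x.toKIdx) (Fin (d + 1)) (TrIdx N)) (PK (FBondY x.toKIdx) (Fin (d + 1)) (TrIdx N)))
    (Dd Dds : ∀ x : MemberY d ℓ hd hL b₀ b₁ Mstar, (bg9YR (Matrix (Fin N) (Fin N) ℂ) (specialUnitaryUnits (Fin N)) R₁ R₂ x).Cfg → Fin (d + 1) → Module.End ℝ (XBK (TrIdx N) x.toKIdx → ℝ))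
    (hDd : ∀ (x : MemberY d ℓ hd hL b₀ b₁ Mstar) (U : (bg9YR (Matrix (Fin N) (Fin N) ℂ) (specialUnitaryUnits (Fin N)) R₁ R₂ x).Cfg), Dd x U = fun μ => coordOpK (trBasis N) (fun _ : Fin (d + 1) => cdBₗ x.toKIdx U μ))
    -- the pins of the operator record and of the probes
    (hblk12 : ∀ x : MemberY d ℓ hd hL b₀ b₁ Mstar, (𝔬12 x).blk = blkBK x.toKIdx (bI x))
    (hblkPX : ∀ x : MemberY d ℓ hd hL b₀ b₁ Mstar, (𝔭A x).blkPX = blkPK (bI x))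
    (hΦX : ∀ (x : MemberY d ℓ hd hL b₀ b₁ Mstar) (U : (bg9YR (Matrix (Fin N) (Fin N) ℂ) (specialUnitaryUnits (Fin N)) R₁ R₂ x).Cfg) (s : ℝ),
      (𝔭A x).ΦX U s = probeK (trBasis N) (taxiB x.toKIdx (bg9YR (Matrix (Fin N) (Fin N) ℂ) (specialUnitaryUnits (Fin N)) R₁ R₂ x) (fun U => U) U) (wKA x.toKIdx s) (w₀K x.toKIdx s))
    (hDvsco12 : ∀ (x : MemberY d ℓ hd hL b₀ b₁ Mstar) (U : (bg9YR (Matrix (Fin N) (Fin N) ℂ) (specialUnitaryUnits (Fin N)) R₁ R₂ x).Cfg),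
      (𝔬12 x).Dvstar U = DvscoKH x.toKIdx (trBasis N) (bg9YR (Matrix (Fin N) (Fin N) ℂ) (specialUnitaryUnits (Fin N)) R₁ R₂ x) (fun U => U) U)
    (hRco12 : ∀ (x : MemberY d ℓ hd hL b₀ b₁ Mstar) (U : (bg9YR (Matrix (Fin N) (Fin N) ℂ) (specialUnitaryUnits (Fin N)) R₁ R₂ x).Cfg),
      (𝔬12 x).R U = RcoK x.toKIdx (trBasis N) (bg9YR (Matrix (Fin N) (Fin N) ℂ) (specialUnitaryUnits (Fin N)) R₁ R₂ x) (fun U => U) (parT x.toKIdx) (GpPhysY x.toKIdx (parT x.toKIdx)) U)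
    -- the input classes of record: flat bond class (source) and transported site class (target)
    (bHX12 : ∀ x : MemberY d ℓ hd hL b₀ b₁ Mstar, ℝ → BlockNorm (toB6 (geo9Y x) 1 (H12 x)) (XBK (TrIdx N) x.toKIdx → ℝ))
    (hbHX12 : ∀ x : MemberY d ℓ hd hL b₀ b₁ Mstar, bHX12 x = fun ε =>
      letI : Fintype (geo9K x.toKIdx).Site := (inferInstance : Fintype (geo9Y x).Site)
      bHK (κ := TrIdx N) x.toKIdx (bI x) ε (R := (1 : ℝ)) (H := H12 x))
    (bHXT : ∀ x : MemberY d ℓ hd hL b₀ b₁ Mstar, (bg9YR (Matrix (Fin N) (Fin N) ℂ) (specialUnitaryUnits (Fin N)) R₁ R₂ x).Cfg → ℝ → BlockNorm (toB6 (geo9Y x) 1 (H12 x)) (XSK (TrIdx N) x.toKIdx → ℝ))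
    (hbHXT : ∀ (x : MemberY d ℓ hd hL b₀ b₁ Mstar) (U : (bg9YR (Matrix (Fin N) (Fin N) ℂ) (specialUnitaryUnits (Fin N)) R₁ R₂ x).Cfg), bHXT x U = fun ε =>
      letI : Fintype (geo9K x.toKIdx).Site := (inferInstance : Fintype (geo9Y x).Site)
      bHZPIfam (κ := TrIdx N) x.toKIdx (trBasis N) (taxiS x.toKIdx (bg9YR (Matrix (Fin N) (Fin N) ℂ) (specialUnitaryUnits (Fin N)) R₁ R₂ x) (fun U => U) U) (R := (1 : ℝ)) (H := H12 x) ε)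
    (bXH : ∀ x : MemberY d ℓ hd hL b₀ b₁ Mstar, (bg9YR (Matrix (Fin N) (Fin N) ℂ) (specialUnitaryUnits (Fin N)) R₁ R₂ x).Cfg → BlockNorm (toB6 (geo9Y x) 1 (H12 x)) (XBK (TrIdx N) x.toKIdx → ℝ))
    -- print's class (3.35) at the letters (the certificate's `hRP1 … .2.1`, `c35Y_le_ten`)
    {c c10 : ℝ} (hc10 : c10 ≤ 10)
    (hP : ∀ (x : MemberY d ℓ hd hL b₀ b₁ Mstar) (α₀ : ℝ) (U : (bg9YR (Matrix (Fin N) (Fin N) ℂ) (specialUnitaryUnits (Fin N)) R₁ R₂ x).Cfg),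
      (bg9YR (Matrix (Fin N) (Fin N) ℂ) (specialUnitaryUnits (Fin N)) R₁ R₂ x).Reg335 c α₀ U → (bg9KP (Matrix (Fin N) (Fin N) ℂ) (specialUnitaryUnits (Fin N)) x.toKIdx).Reg335 c10 α₀ U)
    -- the regime and the numerics
    {M₁ a₁ : ℝ} (ha₁ : 0 < a₁)
    {B12₀ δ12₀ δ12₃ δKR δPR δ49 θS θD12 AD CR κS CP τ : ℝ} {Bh12 Bi12 θH12 AI : ℝ → ℝ} {Bi2₁₂ : ℝ → ℝ → ℝ}
    (hθS : 0 ≤ θS) (hθD12 : 0 ≤ θD12) (hθH12 : ∀ β', 0 ≤ β' → β' < 1 → 0 ≤ θH12 β') (hAI : ∀ ε, 0 < ε → 0 ≤ AI ε) (hCR : 0 ≤ CR) (hCP : 0 ≤ CP)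
    (hBi12 : ∀ ε, 0 < ε → ε ≤ 1 → 0 ≤ Bi12 ε) (hBi2₁₂ : ∀ ε β', 0 < ε → ε ≤ 1 → 0 ≤ β' → β' < 1 → 0 ≤ Bi2₁₂ ε β')
    (hτ : 0 < τ) (hδ30 : 0 ≤ δ12₃) (h3₀ : δ12₃ + 3 * τ ≤ δ12₀) (h3P : δ12₃ + 4 * τ ≤ δPR) (h3K : δ12₃ + 5 * τ ≤ δKR) (h349 : δ12₃ + 3 * τ ≤ δ49)
    -- Theorem 3.3 for G₀ in the direction currency at the flat input class (the face's `(hG0C …).1`)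
    (hG0 : ∀ x : MemberY d ℓ hd hL b₀ b₁ Mstar, M₁ ≤ (geo9Y x).M → ∀ α₀ : ℝ, 0 < α₀ → (geo9Y x).M * α₀ ≤ a₁ →
      ∀ U : (bg9YR (Matrix (Fin N) (Fin N) ℂ) (specialUnitaryUnits (Fin N)) R₁ R₂ x).Cfg, (bg9YR (Matrix (Fin N) (Fin N) ℂ) (specialUnitaryUnits (Fin N)) R₁ R₂ x).Reg335 c α₀ U →
        (bg9YR (Matrix (Fin N) (Fin N) ℂ) (specialUnitaryUnits (Fin N)) R₁ R₂ x).Reg336 c α₀ U → Thm33G0Dir (𝔬12 x) (𝔭A x) (Dd x) (Dds x) 1 (H12 x) (bHX12 x) B12₀ Bh12 Bi12 Bi2₁₂ δ12₀ U)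
    -- the identities of the expansion (the face's `(hmodel12 …).2`)
    (hI : ∀ x : MemberY d ℓ hd hL b₀ b₁ Mstar, M₁ ≤ (geo9Y x).M → ∀ α₀ : ℝ, 0 < α₀ → (geo9Y x).M * α₀ ≤ a₁ →
      ∀ U : (bg9YR (Matrix (Fin N) (Fin N) ℂ) (specialUnitaryUnits (Fin N)) R₁ R₂ x).Cfg, (bg9YR (Matrix (Fin N) (Fin N) ℂ) (specialUnitaryUnits (Fin N)) R₁ R₂ x).Reg335 c α₀ U →
        (bg9YR (Matrix (Fin N) (Fin N) ℂ) (specialUnitaryUnits (Fin N)) R₁ R₂ x).Reg336 c α₀ U → B9Thm312Whole.Identities (𝔬12 x) U)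
    -- the state-layer tuple (the face's `hst10` shape, at the rates `δKR ∕ δPR`)
    (hst : ∀ x : MemberY d ℓ hd hL b₀ b₁ Mstar, M₁ ≤ (geo9Y x).M → ∀ α₀ : ℝ, 0 < α₀ → (geo9Y x).M * α₀ ≤ a₁ →
      ∀ U : (bg9YR (Matrix (Fin N) (Fin N) ℂ) (specialUnitaryUnits (Fin N)) R₁ R₂ x).Cfg, (bg9YR (Matrix (Fin N) (Fin N) ℂ) (specialUnitaryUnits (Fin N)) R₁ R₂ x).Reg335 c α₀ U →
        (bg9YR (Matrix (Fin N) (Fin N) ℂ) (specialUnitaryUnits (Fin N)) R₁ R₂ x).Reg336 c α₀ U →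
        (StepS (𝔬12 x) (bXH x U) (θS * ((geo9Y x).M * α₀)) δKR U ∧
          (∀ ν : Fin (d + 1),
            HasMaj (bXH x U) (cNormR 1 (H12 x) (𝔬12 x).blk (fun y => (geo9Y_len_pos x y).le) 0) (Dd x U ν ∘ₗ (𝔬12 x).G0 U ∘ₗ (𝔬12 x).Tpi U) (fun a b => θD12 * ((geo9Y x).M * α₀) * Real.exp (-(δKR * (geo9Y x).dist a b))) ∧
            HasMaj (bXH x U) (cNormR 1 (H12 x) (𝔬12 x).blk (fun y => (geo9Y_len_pos x y).le) 0) (Dd x U ν ∘ₗ (𝔬12 x).G0 U ∘ₗ ((𝔬12 x).Tpi U + (𝔬12 x).T2 U)) (fun a b => θD12 * ((geo9Y x).M * α₀) * Real.exp (-(δKR * (geo9Y x).dist a b)))) ∧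
          (∀ β' : ℝ, 0 ≤ β' → β' < 1 →
            HasMaj (bXH x U) (cNormR 1 (H12 x) (𝔭A x).blkPX (fun y => (geo9Y_len_pos x y).le) (β' - 1)) (((𝔭A x).ΦX U β' ∘ₗ (𝔬12 x).G0 U) ∘ₗ (𝔬12 x).Tpi U) (fun a b => θH12 β' * ((geo9Y x).M * α₀) * Real.exp (-(δKR * (geo9Y x).dist a b))) ∧
            HasMaj (bXH x U) (cNormR 1 (H12 x) (𝔭A x).blkPX (fun y => (geo9Y_len_pos x y).le) (β' - 1)) (((𝔭A x).ΦX U β' ∘ₗ (𝔬12 x).G0 U) ∘ₗ ((𝔬12 x).Tpi U + (𝔬12 x).T2 U)) (fun a b => θH12 β' * ((geo9Y x).M * α₀) * Real.exp (-(δKR * (geo9Y x).dist a b)))) ∧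
          (∀ (ν : Fin (d + 1)) (β' : ℝ), 0 ≤ β' → β' < 1 →
            HasMaj (bXH x U) (cNormR 1 (H12 x) (𝔭A x).blkPX (fun y => (geo9Y_len_pos x y).le) β') (((𝔭A x).ΦX U β' ∘ₗ Dd x U ν ∘ₗ (𝔬12 x).G0 U) ∘ₗ (𝔬12 x).Tpi U) (fun a b => θH12 β' * ((geo9Y x).M * α₀) * Real.exp (-(δKR * (geo9Y x).dist a b))) ∧
            HasMaj (bXH x U) (cNormR 1 (H12 x) (𝔭A x).blkPX (fun y => (geo9Y_len_pos x y).le) β') (((𝔭A x).ΦX U β' ∘ₗ Dd x U ν ∘ₗ (𝔬12 x).G0 U) ∘ₗ ((𝔬12 x).Tpi U + (𝔬12 x).T2 U)) (fun a b => θH12 β' * ((geo9Y x).M * α₀) * Real.exp (-(δKR * (geo9Y x).dist a b)))) ∧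
          HasMaj (cNormR 1 (H12 x) (𝔬12 x).blkY (fun y => (geo9Y_len_pos x y).le) 0) (bXH x U) ((𝔬12 x).G0 U ∘ₗ (𝔬12 x).Dstar U) (fun a b => AD * Real.exp (-(δPR * (geo9Y x).dist a b))) ∧
          (∀ (μ : Fin (d + 1)) (ε : ℝ), 0 < ε → HasMaj (bHX12 x ε) (bXH x U) ((𝔬12 x).G0 U ∘ₗ Dds x U μ) (fun a b => AI ε * Real.exp (-(δPR * (geo9Y x).dist a b)))) ∧
          HasMaj (bXH x U) (cNormR 1 (H12 x) (𝔬12 x).blk (fun y => (geo9Y_len_pos x y).le) (-1)) LinearMap.id (fun a b => CR * Real.exp (-(δPR * (geo9Y x).dist a b))) ∧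
          (bXH x U).κ ≤ κS ∧
          (∃ Λ : ℝ, 0 ≤ Λ ∧ ∀ (y : (geo9Y x).Site) (F : XBK (TrIdx N) x.toKIdx → ℝ), (bXH x U).loc y F ≤ Λ * ∑ q : XBK (TrIdx N) x.toKIdx, |F q|)))
    -- the ℓ¹ control of the flat input class (the face's `hdomX`)
    (hdomX : ∀ (x : MemberY d ℓ hd hL b₀ b₁ Mstar) (ε : ℝ), 0 < ε → ∃ ΛX : ℝ, 0 ≤ ΛX ∧
      ∀ (y : (geo9Y x).Site) (μ : XBK (TrIdx N) x.toKIdx → ℝ), (bHX12 x ε).IsLoc y μ → ∑ q : XBK (TrIdx N) x.toKIdx, |μ q| ≤ ΛX * (bHX12 x ε).loc y μ)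
    -- (3.49) for P = I − R at the lattice letter (the certificate's `h49`, from `proj349Maj_of_t37_display348_rate`)
    (h49 : ∀ x : MemberY d ℓ hd hL b₀ b₁ Mstar, M₁ ≤ (geo9Y x).M → ∀ α₀ : ℝ, 0 < α₀ → (geo9Y x).M * α₀ ≤ a₁ →
      ∀ U : (bg9YR (Matrix (Fin N) (Fin N) ℂ) (specialUnitaryUnits (Fin N)) R₁ R₂ x).Cfg, (bg9YR (Matrix (Fin N) (Fin N) ℂ) (specialUnitaryUnits (Fin N)) R₁ R₂ x).Reg335 c α₀ U →
        Proj349Maj (g := geo9Y x) (blkSK x.toKIdx (sIK x.toKIdx (bI x))) (blkBK x.toKIdx (bI x))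
          (PcoK x.toKIdx (trBasis N) (bg9YR (Matrix (Fin N) (Fin N) ℂ) (specialUnitaryUnits (Fin N)) R₁ R₂ x) (fun U => U) (parT x.toKIdx) (GpY x.toKIdx (parT x.toKIdx)) U)
          (DvcoKH x.toKIdx (trBasis N) (bg9YR (Matrix (Fin N) (Fin N) ℂ) (specialUnitaryUnits (Fin N)) R₁ R₂ x) (fun U => U) U)
          (DvscoKH x.toKIdx (trBasis N) (bg9YR (Matrix (Fin N) (Fin N) ℂ) (specialUnitaryUnits (Fin N)) R₁ R₂ x) (fun U => U) U) 1 (H12 x) CP δ49) :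
    ∃ (MR aR : ℝ) (Br : ℝ → ℝ → ℝ), M₁ ≤ MR ∧ 0 < aR ∧ aR ≤ a₁ ∧ (∀ ε ε', 0 < ε' → ε' < 1 → ε' < ε → ε ≤ ε' + 1 → 0 ≤ Br ε ε') ∧
      ∀ x : MemberY d ℓ hd hL b₀ b₁ Mstar, MR ≤ (geo9Y x).M → ∀ α₀ : ℝ, 0 < α₀ → (geo9Y x).M * α₀ ≤ aR →
        ∀ U : (bg9YR (Matrix (Fin N) (Fin N) ℂ) (specialUnitaryUnits (Fin N)) R₁ R₂ x).Cfg, (bg9YR (Matrix (Fin N) (Fin N) ℂ) (specialUnitaryUnits (Fin N)) R₁ R₂ x).Reg335 c α₀ U →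
          (bg9YR (Matrix (Fin N) (Fin N) ℂ) (specialUnitaryUnits (Fin N)) R₁ R₂ x).Reg336 c α₀ U →
            ∀ (μ : Fin (d + 1)) (ε ε' : ℝ), 0 < ε' → ε' < 1 → ε' < ε → ε ≤ ε' + 1 →
              HasMaj (bHX12 x ε) (bHXT x U ε') ((𝔬12 x).R U ∘ₗ (𝔬12 x).Dvstar U ∘ₗ (𝔬12 x).G1 U ∘ₗ Dds x U μ)
                (fun (a a' : (geo9Y x).Site) => Br ε ε' * Real.exp (-(δ12₃ * (geo9Y x).dist a a'))) := by
  classical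
  haveI : Nonempty (Fin N) := ⟨⟨0, Nat.pos_of_ne_zero (NeZero.ne N)⟩⟩
  have hN0 : 0 < N := Nat.pos_of_ne_zero (NeZero.ne N)
  set L : ℝ := ((ℓ + 1 : ℕ) : ℝ) with hLdef
  have hL1 : (1 : ℝ) ≤ L := by rw [hLdef]; exact_mod_cast Nat.succ_le_succ (Nat.zero_le ℓ)
  -- the row sum at margin τ, the (2.60) facts at (δF, α) := (2τ, ½), the transfer threshold at ε_t := τ
  obtain ⟨ML, c₁, hrow⟩ := rowSum261_geo9Y (d := d) (ℓ := ℓ) (hd := hd) (hL := hL) (b₀ := b₀) (b₁ := b₁) (Mstar := Mstar) τ hτ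
  set cR : ℝ := max c₁ 0 with hcRdef
  have hcR : 0 ≤ cR := le_max_right _ _
  have h12 : (0 : ℝ) < 1 / 2 := by norm_num
  have h12' : (1 : ℝ) / 2 < 1 := by norm_num
  obtain ⟨Mg, hfacts⟩ := facts347_exp261_geo9Y (d := d) (ℓ := ℓ) (hd := hd) (hL := hL) (b₀ := b₀) (b₁ := b₁) (Mstar := Mstar) H12 h12 h12' (δ := 2 * τ) (by linarith)
  set Mtr : ℝ := Real.log (((ℓ + 1 : ℕ) : ℝ)) / (τ * (2 * ((ℓ : ℝ) + 1) ^ 2 - 1)) with hMtr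
  -- the output regime: the smallness `κS·θS·Mα₀·c ≤ ½` of leg (A)
  set κS' : ℝ := max κS 0 with hκS'
  have hκS' : 0 ≤ κS' := le_max_right _ _
  set aR : ℝ := min a₁ (1 / (2 * (κS' * θS * cR + 1))) with haRdef
  have hden : 0 < 2 * (κS' * θS * cR + 1) := by positivity
  have haR0 : 0 < aR := lt_min ha₁ (by positivity)
  have haR1 : aR ≤ a₁ := min_le_left _ _
  have haRs : κS' * θS * cR * aR ≤ 1 / 2 := by
    have h1 : aR ≤ 1 / (2 * (κS' * θS * cR + 1)) := min_le_right _ _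
    have h2 : 0 ≤ κS' * θS * cR := by positivity
    calc κS' * θS * cR * aR ≤ κS' * θS * cR * (1 / (2 * (κS' * θS * cR + 1))) := mul_le_mul_of_nonneg_left h1 h2
      _ = (κS' * θS * cR) / (κS' * θS * cR + 1) * (1 / 2) := by field_simp
      _ ≤ 1 * (1 / 2) := by
          refine mul_le_mul_of_nonneg_right ?_ (by norm_num)
          rw [div_le_one (by positivity)]; linarith
      _ = 1 / 2 := one_mul _
  -- the rates
  set ρA : ℝ := δ12₃ + 3 * τ with hρA
  set ρ₃ : ℝ := ρA - τ with hρ₃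
  set ρ₁ : ℝ := δ12₃ + τ with hρ₁
  set δJ : ℝ := (δ12₃ + 4 * τ) - 1 / 2 * (2 * τ) with hδJ
  have hρA0 : 0 ≤ ρA := by rw [hρA]; positivity
  have hδJ0 : 0 ≤ δJ := by rw [hδJ]; linarith
  -- the ladder regime bound and the letters' constants
  set KT : ℝ := 10 * L * a₁ with hKT
  set CJ : ℝ := (L ^ 4 * coordBound39 (trBasis N) * basisBound39 (trBasis N) *
      (2 + 2 * L ^ 4 + 2 * ((((d + 1 : ℕ) : ℝ)) * (2 * KT * (1 + KT) * Real.exp (4 * KT)) * L ^ 6) * L ^ 2)) *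
    Real.exp (δJ * (2 * (rNear d ℓ + 1) + 2 * (((d : ℝ) + 1) * (((ℓ : ℝ) + 1) + 1) + 2))) with hCJ
  have hcb : 0 ≤ coordBound39 (trBasis N) := by unfold coordBound39; exact norm_nonneg _
  have hbb : 0 ≤ basisBound39 (trBasis N) := Finset.sum_nonneg fun _ _ => norm_nonneg _
  have hKT0 : 0 ≤ KT := by rw [hKT]; positivity
  have hCJn : 0 ≤ CJ := by positivity
  set CJ0 : ℝ := cR39 (trBasis N) * Real.exp ((δ12₃ + 4 * τ) * rJ d ℓ) * L with hCJ0def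
  have hCJ00 : 0 ≤ CJ0 := by have := cR39_nonneg (trBasis N); positivity
  set ϱ : ℝ := (cR39 (trBasis N))⁻¹ with hϱ
  -- the uniform constants of leg (A)'s members (iii)∕(iv)
  set C3 : ℝ → ℝ := fun ε => Bi12 (min ε 1) + κS' * (θD12 * aR) * (2 * AI (min ε 1)) * cR with hC3
  set C4 : ℝ → ℝ → ℝ := fun ε ε' => Bi2₁₂ (ε - ε') ε' + κS' * (θH12 ε' * aR) * (2 * AI ε) * cR with hC4
  -- the profile: dag-n06-l's closed form at `L`, `|PI| = d + 1`
  set Br : ℝ → ℝ → ℝ := fun ε ε' => L * ((((Fintype.card (Fin (d + 1)) : ℝ)) * ((1 + CLip d ℓ) * CJ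
          * ((L * (|ϱ| * (L * C3 ε)) + L ^ (1 - ε') * (|ϱ| * (L * C4 ε ε'))) * Real.exp ((ρ₃ - τ) * (rNear d ℓ + 1))) * cR)
        + CTel d ℓ (trBasis N) ρ₁ (CP * L * (((Fintype.card (Fin (d + 1)) : ℝ)) * (1 * CJ0 * (|ϱ| * (L * C3 ε)) * cR)) * cR)
          (CP * L * (((Fintype.card (Fin (d + 1)) : ℝ)) * (1 * CJ0 * (|ϱ| * (L * C3 ε)) * cR)) * cR))) with hBr
  have hC3n : ∀ ε, 0 < ε → 0 ≤ C3 ε := by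
    intro ε hε
    have hm0 : 0 < min ε 1 := lt_min hε one_pos
    have hm1 : min ε 1 ≤ 1 := min_le_right _ _
    have := hBi12 _ hm0 hm1; have := hAI _ hm0
    simp only [hC3]; positivity
  have hC4n : ∀ ε ε', 0 < ε' → ε' < 1 → ε' < ε → ε ≤ ε' + 1 → 0 ≤ C4 ε ε' := by
    intro ε ε' h0 h1 h2 h3
    have := hBi2₁₂ (ε - ε') ε' (by linarith) (by linarith) h0.le h1; have := hAI ε (by linarith); have := hθH12 ε' h0.le h1
    simp only [hC4]; positivity
  refine ⟨max M₁ (max Mg (max ML Mtr)), aR, Br, le_max_left _ _, haR0, haR1, fun ε ε' h0 h1 h2 h3 => ?_, fun x hM α₀ hα ha U hU hU' μ ε ε' hε'0 hε'1 hε'ε hεε' => ?_⟩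
  · have := hC3n ε (by linarith); have := hC4n ε ε' h0 h1 h2 h3; have := CLip_nonneg d ℓ
    have hCT : 0 ≤ CTel d ℓ (trBasis N) ρ₁ (CP * L * (((Fintype.card (Fin (d + 1)) : ℝ)) * (1 * CJ0 * (|ϱ| * (L * C3 ε)) * cR)) * cR)
        (CP * L * (((Fintype.card (Fin (d + 1)) : ℝ)) * (1 * CJ0 * (|ϱ| * (L * C3 ε)) * cR)) * cR) :=
      B9SmoothHolderClassPProducers.CTel_nonneg (trBasis N) (by positivity) (by positivity)
    simp only [hBr]; positivity
  -- AT THE MEMBER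
  letI : Fintype (geo9K x.toKIdx).Site := (inferInstance : Fintype (geo9Y x).Site)
  have hM1x : M₁ ≤ (geo9Y x).M := (le_max_left _ _).trans hM
  have hMgx : Mg ≤ (geo9Y x).M := ((le_max_left _ _).trans (le_max_right _ _)).trans hM
  have hMLx : ML ≤ (geo9Y x).M := (((le_max_left _ _).trans (le_max_right _ _)).trans (le_max_right _ _)).trans hM
  have hMtrx : Mtr ≤ (geo9Y x).M := (((le_max_right _ _).trans (le_max_right _ _)).trans (le_max_right _ _)).trans hM
  have ha1 : (geo9Y x).M * α₀ ≤ a₁ := ha.trans haR1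
  have hMα : 0 ≤ (geo9Y x).M * α₀ := by rw [geo9Y_M]; positivity
  have hG : GeoOK (geo9K x.toKIdx) := ⟨geo9Y_dist_triangle x, geo9Y_dist_comm x, geo9K_dist_nonneg x.toKIdx, geo9Y_len_pos x⟩
  have hF : Facts347 (geo9K x.toKIdx) 1 (H12 x) (exp261 (@geo9Y d ℓ hd hL b₀ b₁ Mstar) (2 * τ) (1 - 1 / 2)) (2 * τ) (1 / 2) (((ℓ + 1 : ℕ) : ℝ)) := hfacts x hMgx
  have hrowx : RowSum (toB6 (geo9K x.toKIdx) 1 (H12 x)) τ cR := fun y => (hrow x hMLx y).trans (le_max_left _ _)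
  have htr : Real.log (geo9K x.toKIdx).L ≤ τ * (2 * ((ℓ : ℝ) + 1) ^ 2 - 1) * (geo9K x.toKIdx).M := transfer_threshold_geo9K x.toKIdx hτ hMtrx
  have hreg := hP x α₀ U hU
  have hG1 : ∀ u : (Matrix (Fin N) (Fin N) ℂ)ˣ, u ∈ specialUnitaryUnits (Fin N) → ‖(u : Matrix (Fin N) (Fin N) ℂ)‖ ≤ 1 := fun u hu => (specialUnitaryUnits_le_U1 hu).1
  have hUL : ∀ (ν : Fin (d + 1)) (t : Site (B6GlobalChartV1.PV d ℓ x.toKIdx.m x.toKIdx.K hd hL) 0), UnitaryLike (U ν t) :=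
    fun ν t => norm_le_one_and_inv_of_mem (specialUnitaryUnits (Fin N)) hG1 (mem_of_reg335P x.toKIdx hreg ν t)
  have hcf : |x.toKIdx.cf| = (B6Prop22KLevelTorusCensusEta.nKT (Node00.toKT x.toKIdx) : ℝ) := abs_cf_eq_nKT x.toKIdx x.hcfk
  -- LEG (A): the pair members of `G₁∇*_μ` out of the state
  obtain ⟨hS1, hTp, hXp, hXd, hAD, hPDds, hRd1, hκ, Λ₁, hΛ₁, hdom1⟩ := hst x hM1x α₀ hα ha1 U hU hU'
  have hθ : 0 ≤ θS * ((geo9Y x).M * α₀) := mul_nonneg hθS hMα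
  have hθ' : 0 ≤ θD12 * ((geo9Y x).M * α₀) := mul_nonneg hθD12 hMα
  have hq1 : (bXH x U).κ * (θS * ((geo9Y x).M * α₀)) * cR ≤ 1 / 2 := by
    have h1 : (bXH x U).κ ≤ κS' := hκ.trans (le_max_left _ _)
    have h2 : θS * ((geo9Y x).M * α₀) ≤ θS * aR := mul_le_mul_of_nonneg_left ha hθS
    calc (bXH x U).κ * (θS * ((geo9Y x).M * α₀)) * cR ≤ κS' * (θS * aR) * cR :=
          mul_le_mul_of_nonneg_right (mul_le_mul h1 h2 hθ hκS') hcR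
      _ = κS' * θS * cR * aR := by ring
      _ ≤ 1 / 2 := haRs
  obtain ⟨-, -, h3A, h4A⟩ := g1Pair_members_of_stateS (P := Fin (d + 1)) hG (𝔭A x) (𝔬 := 𝔬12 x) (U := U) (Dd := Dd x) (Dds := Dds x) (bHX := bHX12 x) (bXH x U)
    (θ := θS * ((geo9Y x).M * α₀)) (θ' := θD12 * ((geo9Y x).M * α₀)) (B₀ := B12₀) (CR₁ := CR) (Λ₁ := Λ₁) (δ₀ := δ12₀) (δK := δKR) (δP := δPR)
    (ρ := ρA) (σ := τ) (c := cR) (θH := fun β' => θH12 β' * ((geo9Y x).M * α₀)) (AI := AI) (Bh := Bh12) (Bi := Bi12) (Bi2 := Bi2₁₂)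
    hrowx hθ hθ' (fun β' hb0 hb1 => mul_nonneg (hθH12 β' hb0 hb1) hMα) hAI hCR hBi12 hBi2₁₂
    (by rw [hρA]; linarith) hτ.le (by rw [hρA]; exact h3₀) (by rw [hρA]; linarith) (by rw [hρA]; linarith) hq1
    (hG0 x hM1x α₀ hα ha1 U hU hU') (hI x hM1x α₀ hα ha1 U hU hU') hS1 hPDds (fun ν => (hTp ν).2) (fun ν β' hb0 hb1 => (hXd ν β' hb0 hb1).2) hRd1 hΛ₁ hdom1
    (hdomX x)
  -- the guards of the two readings
  have hm0 : 0 < min ε 1 := lt_min (by linarith) one_pos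
  have hm1 : min ε 1 ≤ 1 := min_le_right _ _
  have hmε : min ε 1 ≤ ε := min_le_left _ _
  have hε0 : 0 < ε := by linarith
  have hd0 : 0 < ε - ε' := by linarith
  have hd1 : ε - ε' ≤ 1 := by linarith
  have hρ₃eq : ρA - τ = ρ₃ := rfl
  -- (iii) the sup member `∇_ν ∘ (G₁∇*_μ)` INTO the sharp blocks: constant made uniform, source climbed to `ε`
  have hs0 : 0 ≤ ε' := hε'0.le
  have hs1 : ε' ≤ 1 := hε'1.le
  have hκ' : (bXH x U).κ ≤ κS' := hκ.trans (le_max_left _ _)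
  have h3 : ∀ ν : Fin (d + 1), HasMaj (bHK (κ := TrIdx N) x.toKIdx (bI x) ε (R := (1 : ℝ)) (H := H12 x))
      (BlockNorm.ofBlocks (toB6 (geo9K x.toKIdx) 1 (H12 x)) (blkBK x.toKIdx (bI x))) (Dd x U ν ∘ₗ ((𝔬12 x).G1 U ∘ₗ Dds x U μ))
      (fun a a' => C3 ε * Real.exp (-(ρ₃ * (geo9K x.toKIdx).dist a a'))) := by
    intro ν
    have h := h3A (ν, μ) (min ε 1) hm0 hm1
    rw [hbHX12 x, hblk12 x] at h
    have hAI' : 0 ≤ 2 * AI (min ε 1) := mul_nonneg zero_le_two (hAI _ hm0)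
    have hle : Bi12 (min ε 1) + (bXH x U).κ * (θD12 * ((geo9Y x).M * α₀)) * (2 * AI (min ε 1)) * cR ≤ C3 ε := by
      simp only [hC3]
      refine add_le_add le_rfl (mul_le_mul_of_nonneg_right (mul_le_mul_of_nonneg_right ?_ hAI') hcR)
      exact mul_le_mul hκ' (mul_le_mul_of_nonneg_left ha hθD12) hθ' hκS'
    have h' : HasMaj (bHK (κ := TrIdx N) x.toKIdx (bI x) (min ε 1) (R := (1 : ℝ)) (H := H12 x))
        (BlockNorm.ofBlocks (toB6 (geo9K x.toKIdx) 1 (H12 x)) (blkBK x.toKIdx (bI x))) (Dd x U ν ∘ₗ ((𝔬12 x).G1 U ∘ₗ Dds x U μ))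
        (fun a a' => C3 ε * Real.exp (-(ρ₃ * (geo9K x.toKIdx).dist a a'))) :=
      h.mono fun a a' => mul_le_mul hle le_rfl (Real.exp_nonneg _) (hC3n ε hε0)
    exact hasMaj_bHK_of_le x.toKIdx (bI x) (fun a a' => mul_nonneg (hC3n ε hε0) (Real.exp_nonneg _)) hm0 hmε h'
  -- (iv) the probe member `Φ^X_{ε′}∇_ν ∘ (G₁∇*_μ)` INTO `𝔠_P^{(ε′)}` at `(ε − ε′, ε′)`: source exponent `ε′ + (ε − ε′) = ε`, constant made uniform
  have h4 : ∀ ν : Fin (d + 1), HasMaj (bHK (κ := TrIdx N) x.toKIdx (bI x) ε (R := (1 : ℝ)) (H := H12 x))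
      (cNormR 1 (H12 x) (blkPK (bI x)) hG.lenle ε')
      (probeK (trBasis N) (taxiB x.toKIdx (bg9YR (Matrix (Fin N) (Fin N) ℂ) (specialUnitaryUnits (Fin N)) R₁ R₂ x) (fun U => U) U) (wKA x.toKIdx ε') (w₀K x.toKIdx ε') ∘ₗ
        (Dd x U ν ∘ₗ ((𝔬12 x).G1 U ∘ₗ Dds x U μ)))
      (fun a a' => C4 ε ε' * Real.exp (-(ρ₃ * (geo9K x.toKIdx).dist a a'))) := by
    intro ν
    have h := h4A (ν, μ) (ε - ε') ε' hd0 hd1 hs0 hε'1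
    rw [show ε' + (ε - ε') = ε by ring, hbHX12 x, hblkPX x, hΦX x U ε', LinearMap.comp_assoc] at h
    have hAI' : 0 ≤ 2 * AI ε := mul_nonneg zero_le_two (hAI _ hε0)
    have hθHx : 0 ≤ θH12 ε' * ((geo9Y x).M * α₀) := mul_nonneg (hθH12 ε' hs0 hε'1) hMα
    have hle : Bi2₁₂ (ε - ε') ε' + (bXH x U).κ * (θH12 ε' * ((geo9Y x).M * α₀)) * (2 * AI ε) * cR ≤ C4 ε ε' := by
      simp only [hC4]
      refine add_le_add le_rfl (mul_le_mul_of_nonneg_right (mul_le_mul_of_nonneg_right ?_ hAI') hcR)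
      exact mul_le_mul hκ' (mul_le_mul_of_nonneg_left ha (hθH12 ε' hs0 hε'1)) hθHx hκS'
    exact h.mono fun a a' => mul_le_mul hle le_rfl (Real.exp_nonneg _) (hC4n ε ε' hε'0 hε'1 hε'ε hεε')
  -- the letters `J†_ν` (this seat, ladder-free) at the common rate `δJ`
  have hK10 : 10 * (((ℓ + 1 : ℕ) : ℝ)) * ((geo9Y x).M * α₀) ≤ KT := by
    rw [hKT, hLdef]; exact mul_le_mul_of_nonneg_left ha1 (by positivity)
  have hJT : ∀ ν : Fin (d + 1),
      HasMaj (B9SmoothHolderClassP.bHZKP (κ := TrIdx N) x.toKIdx (trBasis N) (taxiB x.toKIdx (bg9YR (Matrix (Fin N) (Fin N) ℂ) (specialUnitaryUnits (Fin N)) R₁ R₂ x) (fun U => U) U) (R := (1 : ℝ)) (H := H12 x) hs0 hs1)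
        (B9SmoothHolderClassP.bHZP (κ := TrIdx N) x.toKIdx (trBasis N) (taxiS x.toKIdx (bg9YR (Matrix (Fin N) (Fin N) ℂ) (specialUnitaryUnits (Fin N)) R₁ R₂ x) (fun U => U) U) (R := (1 : ℝ)) (H := H12 x) hs0 hs1)
        (JTcoKH x.toKIdx (trBasis N) (bg9YR (Matrix (Fin N) (Fin N) ℂ) (specialUnitaryUnits (Fin N)) R₁ R₂ x) (fun U => U) ν U)
        (fun a a' => CJ * Real.exp (-(δJ * (geo9Y x).dist a a'))) := fun ν =>
    hasMaj_JTcoKH_bHZKP_bHZP_pinsR x (H := H12 x) (hβ1 x) hc10 hα.le hK10 hreg hs0 hs1 hδJ0 ν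
  have hδ4 : 0 ≤ δ12₃ + 4 * τ := by linarith
  have hJT0 : ∀ ν : Fin (d + 1),
      HasMaj (cNormR (1 : ℝ) (H12 x) (blkBK x.toKIdx (bI x)) hG.lenle (-1)) (cNormR (1 : ℝ) (H12 x) (blkSK x.toKIdx (sIK x.toKIdx (bI x))) hG.lenle (-1))
        (JTcoKH x.toKIdx (trBasis N) (bg9YR (Matrix (Fin N) (Fin N) ℂ) (specialUnitaryUnits (Fin N)) R₁ R₂ x) (fun U => U) ν U)
        (fun a a' => CJ0 * Real.exp (-(δJ * (geo9Y x).dist a a'))) := fun ν =>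
    hasMaj_JTcoKH_cNormR_neg_one_pinsR x (H := H12 x) hG hF (hβ1 x) hreg hδ4 ν
  -- the split `D*_U = Σ_ν J†_ν ∘ ∇_ν` and `R = ϱ(I − P)` at the pins; (3.49)'s words of `P`
  have hDvs : (𝔬12 x).Dvstar U = ∑ ν : Fin (d + 1), JTcoKH x.toKIdx (trBasis N) (bg9YR (Matrix (Fin N) (Fin N) ℂ) (specialUnitaryUnits (Fin N)) R₁ R₂ x) (fun U => U) ν U ∘ₗ Dd x U ν := by
    rw [hDvsco12 x U, hDd x U, DvscoKH_eq_sum]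
  have hR : (𝔬12 x).R U = ϱ • (LinearMap.id -
      PcoK x.toKIdx (trBasis N) (bg9YR (Matrix (Fin N) (Fin N) ℂ) (specialUnitaryUnits (Fin N)) R₁ R₂ x) (fun U => U) (parT x.toKIdx) (GpY x.toKIdx (parT x.toKIdx)) U) := by
    rw [hRco12 x U, rcoK_GpPhysY, rcoK_eq]
  have h49x := h49 x hM1x α₀ hα ha1 U hU
  have hP49 := h49x.p_cls hG hCP h349
  have hDvP49 := h49x.dvP_cls hG hCP h349
  -- dag-n06-l's print-currency core
  have hρ₃τ : τ ≤ ρ₃ := by simp only [hρ₃, hρA]; linarith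
  have hρ₁0 : 0 ≤ ρ₁ := by simp only [hρ₁]; linarith
  have hρ₁V : ρ₁ ≤ ρ₃ - τ := by simp only [hρ₁, hρ₃, hρA]; linarith
  have hρ₁J : ρ₁ + τ ≤ δJ := by simp only [hρ₁, hδJ]; linarith
  have hbud : ρ₁ + τ + 1 / 2 * (2 * τ) ≤ δ12₃ + 3 * τ := by simp only [hρ₁]; linarith
  have key := hasMaj_R_dvs_comp_into_bHZPIfam x.toKIdx (trBasis N) (B := bg9YR (Matrix (Fin N) (Fin N) ℂ) (specialUnitaryUnits (Fin N)) R₁ R₂ x) (cfg := fun U => U)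
    (R₀ := (1 : ℝ)) (H₀ := H12 x) hs0 hs1 hG hF hrowx hτ htr (hβ1 x) (hlev x) (hbI0 x) hcf (U := U) hUL (PI := Fin (d + 1))
    (T := (𝔬12 x).G1 U ∘ₗ Dds x U μ) (N₀ := bHK (κ := TrIdx N) x.toKIdx (bI x) ε (R := (1 : ℝ)) (H := H12 x))
    hCP hCJn hCJ00 (hC3n ε hε0) (hC4n ε ε' hε'0 hε'1 hε'ε hεε') hcR hρ₃τ hρ₁0 hρ₁V hρ₁J hρ₁0 le_rfl hbud hR hDvs hP49 hDvP49 hJT hJT0 h3 h4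
  have hρeq : ρ₁ - τ = δ12₃ := by simp only [hρ₁]; ring
  have hLx : (geo9K x.toKIdx).L = L := rfl
  rw [hρeq, hLx] at key
  rw [hbHX12 x, hbHXT x U]
  exact key

end Summit.QuantumFields.YangMills.BalabanUVNodes.N06RgddLegAtPinsTPar
end
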